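import Summits.BirchSwinnertonDyer.BirchSwinnertonDyer.Theorems.TeichmullerTwistDescentKOfIntHeckeProjector
import Literature.NumberTheory.ModularSymbols.CuspidalHomologyHeckeQuasiProjector
import HarnessLib

/-!
# Route `TeichmullerTwistDescent`, crux K `TwistedPeriodLatticeSaturation` (stmt-BirchSwinnertonDyer-25368):
# K, LITERALLY, from modularity + RATIONAL MULTIPLICITY ONE for `f_E` + the tame-type carrier functional

Cell `pub/bsd-wall` (D-0145 line route-BirchSwinnertonDyer-TeichmullerTwistDescent, OPEN rev 7), seat `bsd-line-ttd-p1`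
(prover 1/2, g24).  THEOREMS ONLY (no definition, no named fact, no `sorry`).  BSD is not proved by this file; K is NOT
proved by this file: the main theorem is CONDITIONAL, with the route decl `TwistedPeriodLatticeSaturation` verbatim as its
conclusion.  Compared with `TeichmullerTwistDescentKOfIntHeckeProjector`, the Hecke hypothesis is now plain RATIONAL
(GENERALISED) MULTIPLICITY ONE for the newform `f = D.f` of the curve:

* `hMO1` — for a curve of conductor `N`, its modular parametrisation datum `D` and a prime `p ≥ 11` with `p² ∣ N`, there are
  finitely many primes `q_i ≠ p` with `T_{q_i} f = a_i f` (`a_i ∈ ℤ`) such that the joint generalised `a`-eigenspace of the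
  `T_{q_i}` on `H(N; ℚ) = ℚ ⊗ H₁(X₀(N), ℤ)` meets `ker(periodClassK f)` trivially — i.e. the generalised `λ_f`-eigenspace for
  these `T_q` is the `f`-part, on which the period map of `f` is injective (Eichler–Shimura: it is `2`-dimensional; strong
  multiplicity one: `q_i ∤ N` separating `f` from the other eigen-systems exist; semisimplicity of `T_q`, `q ∤ N`).

The integral Hecke quasi-projector is then PRODUCED (`Literature.…CuspidalHomologyHeckeQuasiProjector.exists_intHeckeQuasiProjector`:
Fitting quasi-projectors in `ℚ[T_q]`, clearing denominators, descent to `H₁(X₀(N), ℤ)`), and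
`KOfIntHeckeProjector.twistedPeriodLatticeSaturation_of_intHeckeProjector` applies.  REMAINING INPUTS of the K-line after this file:
`hMO1` (rational multiplicity one, cite-level: Shimura Thm. 3.51, Diamond–Shurman Thm. 6.5.4 / Prop. 6.6.4), `hcar` (the integral
tame-type carrier functional — the load-bearing open input), `hnf` (modularity).
-/

set_option linter.dupNamespace false

noncomputable section

open scoped Pointwise MatrixGroups TensorProduct

open Function CongruenceSubgroup
open Literature.RepresentationTheory.FiniteGroups Literature.RepresentationTheory.FiniteGroups.GL2
  Literature.NumberTheory.EllipticCurves.ModularForms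
open Literature.NumberTheory.EllipticCurves (Kato2004.teichmullerChar)
open Literature.NumberTheory.ModularSymbols Literature.NumberTheory.ModularSymbols.FullLevel
open Literature.Algebra.Homology

namespace Summit.BirchSwinnertonDyer.BirchSwinnertonDyer.Theorems.TeichmullerTwistDescent.KOfRationalMultOne

open WeierstrassCurve Literature.NumberTheory.EllipticCurves
  Summit.BirchSwinnertonDyer.BirchSwinnertonDyer.Theorems.TeichmullerTwistDescent.KOfIntHeckeProjector

/-- **K from modularity, rational multiplicity one for `f_E`, and the integral tame-type carrier functional.**  The conclusion is
the route decl `TwistedPeriodLatticeSaturation` VERBATIM; BSD is not proved by this, K only CONDITIONALLY on the three hypotheses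
described in the module docstring.  Proof: `hMO1` ⇒ the integral Hecke quasi-projector (`exists_intHeckeQuasiProjector`) ⇒
`twistedPeriodLatticeSaturation_of_intHeckeProjector`. [cite: Shimura1971, Thm. 3.51] [cite: EdixhovenManin1991, §4]
[cite: AshStevens1986, §1 (1.2)–(1.4)] [cite: EmertonGeeSavitt2015, Lemma 4.1.1] -/
theorem twistedPeriodLatticeSaturation_of_rationalMultOne (hnf : exists_isNewformOf)
    (hMO1 : ∀ (N p : ℕ) [NeZero N] [Fact p.Prime] (W : WeierstrassCurve ℚ) [W.IsElliptic] [W.IsGloballyMinimal],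
      W.conductorNorm ℤ = N → ∀ D : ModularParametrizationData W N, p ^ 2 ∣ N → 11 ≤ p →
      ∃ (s : Finset {q : ℕ // q.Prime ∧ q ≠ p}) (a : {q : ℕ // q.Prime ∧ q ≠ p} → ℤ),
        (∀ i ∈ s, HeckeRing0.toEnd N 2 (HeckeRing0.T N 2 i.1 i.2.1) D.f = (a i : ℂ) • D.f) ∧
        ∀ v : CuspidalHomologyHeckeModule N ℚ,
          (∀ i ∈ s, v ∈ Module.End.maxGenEigenspace (heckeOp N ℚ i.1 i.2.1) (a i : ℚ)) →
            periodClassK N ℚ D.f v = 0 → v = 0)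
    (hcar : ∀ (p M : ℕ) [Fact p.Prime] [NeZero M] [NeZero (p ^ 2 * M)] (hpM : Nat.Coprime p M)
      [Fintype (diagTorus (ZMod p))] [Invertible (Fintype.card (diagTorus (ZMod p)) : ℤ_[p])]
      (W : WeierstrassCurve ℚ) [W.IsElliptic] [W.IsGloballyMinimal], W.conductorNorm ℤ = p ^ 2 * M →
      ∀ D : ModularParametrizationData W (p ^ 2 * M), 11 ≤ p → Rank1Residual.Addv W p → Rank1Residual.Irr W p →
      Summit.BirchSwinnertonDyer.Rank1Residual.Additive.TypeGOrd W p → padicValInt p W.minimalDiscriminantInt ≤ 4 →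
      ∃ (b m : ℕ) (Ψ : spreadLattice ℤ_[p] p M hpM D.f →ₗ[ℤ_[p]] (Option (ZMod p) → ℤ_[p])),
        0 < b ∧ 2 * b < p - 1 ∧
        IsEquivariantOnSpread ℤ_[p] p M hpM D.f
          (coordRep (Kato2004.teichmullerChar p ^ (p - 1 - b)) (Kato2004.teichmullerChar p ^ b)) Ψ ∧
        (∀ v : Option (ZMod p) → ℤ_[p], (p : ℤ_[p]) ^ m • v ∈ LinearMap.range Ψ) ∧
        ∀ Λ' : Subrepresentation (coordRep (Kato2004.teichmullerChar p ^ (p - 1 - b)) (Kato2004.teichmullerChar p ^ b)),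
          Λ'.toSubmodule = LinearMap.range Ψ →
            @ReductionSocleLe p _ (ZMod p) _ _ (PadicInt.toZMod (p := p)).toAlgebra
              (Kato2004.teichmullerChar p ^ (p - 1 - b)) (Kato2004.teichmullerChar p ^ b) (2 * b) Λ') :
    Summit.BirchSwinnertonDyer.BirchSwinnertonDyer.Theses.TeichmullerTwistDescent.TwistedPeriodLatticeSaturation := by
  refine twistedPeriodLatticeSaturation_of_intHeckeProjector hnf (fun N p _ _ W _ _ hN D hsq hp11 => ?_) hcar
  obtain ⟨s, a, hT, hMO⟩ := hMO1 N p W hN D hsq hp11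
  exact exists_intHeckeQuasiProjector N p D.f s (fun i => i.1) (fun i => i.2.1) (fun i => i.2.2) a hT hMO

end Summit.BirchSwinnertonDyer.BirchSwinnertonDyer.Theorems.TeichmullerTwistDescent.KOfRationalMultOne
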